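import Mathlib.LinearAlgebra.QuadraticForm.Basic
import Literature.AlgebraicGeometry.HodgeTheory.ChernCharacterBetti
import Literature.AlgebraicGeometry.HodgeTheory.ComplexConjugation
import Literature.AlgebraicTopology.SingularHomology.PoincareDuality
import HarnessLib

/-!
# The Beauville–Bogomolov quadratic form: Beauville's cohomological formula

Layer `Literature/AlgebraicGeometry/Hyperkaehler`. Part of the sub-layer requested by the definition
item `defn-IsOfOGradySixType` ("compact hyper-Kähler manifold, deformation equivalence, **the
Beauville–Bogomolov form**, `Aut₀`"; the other three notions are `Geometry.Hyperkaehler.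
IsIrreducibleSymplectic`, `Geometry.Kaehler.IsDeformationEquivalent`, `Hyperkaehler.autZero` /
`Hyperkaehler.IsOfOGradySixType` in `OGradySixType.lean`, whose module docstring lists this form under
"Not here").

## Sources (read; PDF pages of the materialised texts)

* A. Beauville, *Variétés kählériennes dont la première classe de Chern est nulle*, J. Differential
  Geom. 18 (1983) 755–782, §8, p. 772 (PDF p. 18 of the held scan): for `X` compact Kähler
  irreducible symplectic of dimension `2r` with symplectic structure `φ`, "Nous normaliserons la
  structure symplectique […] de façon que `∫ (φ φ̄)^r = 1`. […] Posons, pour `α ∈ H²(X, ℂ)`" — the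
  displayed formula, `q(α) = (r/2) ∫_X α²(φφ̄)^{r-1} + (1 - r)(∫_X α φ^{r-1}φ̄^r)(∫_X α φ^rφ̄^{r-1})`,
  is garbled in the scan's text layer and is transcribed here from Huybrechts' verbatim restatement
  below (`n = r`, `σ = φ`) — and **Théorème 5 (a)** (legible): "La forme quadratique `q` est non
  dégénérée; à un scalaire réel positif près, elle provient d'une forme quadratique entière sur
  `H²(X, ℤ)`, de signature `(3, b - 3)`."
* D. Huybrechts, *Compact hyperkähler manifolds: basic results*, Invent. Math. 135 (1999)
  (arXiv:alg-geom/9705025), §1.9 (arXiv p. 4), verbatim: "Let `X` be an irreducible symplectic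
  manifold and let `σ ∈ H⁰(X, Ω²_X)` such that `∫(σσ̄)ⁿ = 1`. Define a quadratic form on `H²(X, ℝ)`
  by `f(α) = (n/2)∫(σσ̄)^{n-1}α² + (1-n)(∫σ^{n-1}σ̄ⁿα)·(∫σⁿσ̄^{n-1}α)`. […] The upshot is: There
  exists a positive constant `c ∈ ℝ` such that `q_X := c·f` is a primitive integral quadratic form
  on `H²(X, ℤ)` of index `(3, b₂(X) - 3)`", and §1.11 (Fujiki: `∫ β^{2n} = c q_X(β)ⁿ`).
* A. Hatcher, *Algebraic Topology* (2002), §3.2 (cup product, cohomology ring), §3.3 p. 249 (the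
  pairing `(a ⌣ b)[X]`).

## Rendering (tree carriers) and design

Everything is COHOMOLOGICAL, on the tree's real carriers: `Hᵏ(Y; ℂ) = singularCohomology ℂ ℂ Y k`
of a topological space `Y` (for a `ℂ`-scheme `X`, `HodgeTheory.complexBetti X k` IS
`singularCohomology ℂ ℂ (Motives.ComplexPoints X) k`, so every definition below applies verbatim to
`Y = X(ℂ)`), the Alexander–Whitney cup product `cupProduct`, complex conjugation of classes
`HodgeTheory.conjClass` (Voisin I Cor. 6.12), cup powers `HodgeTheory.cupPowTwo x i = xⁱ ∈ H²ⁱ`, and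
"integration" `∫_Y c := ⟨c, [Y]_μ⟩`, the Kronecker pairing with the fundamental class of a
homological `ℂ`-orientation `μ` of `Y` in dimension `d` (`cupPairing μ h a b = ⟨a ⌣ b, [Y]_μ⟩`,
`SingularHomology/PoincareDuality`). Beauville's integrals of wedge products of closed forms are
these pairings of cup products of their de Rham classes (de Rham's theorem is multiplicative;
Bott–Tu, Thm. 14.28), so on classes the printed formula reads, for `d = 4n` the real dimension:

  `f_σ(α) = (n/2) ⟨(α ⌣ α) ⌣ (σ^{n-1} ⌣ σ̄^{n-1}), [Y]⟩
            + (1 - n) ⟨α ⌣ (σ^{n-1} ⌣ σ̄ⁿ), [Y]⟩ · ⟨α ⌣ (σⁿ ⌣ σ̄^{n-1}), [Y]⟩`.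

All classes involved have EVEN degree, so the order of the factors is immaterial mathematically
(graded commutativity, the tree's named fact `cupProduct_gradedComm`); ONE order is fixed here
(`mixedPow σ a b = σᵃ ⌣ σ̄ᵇ`, and `α`, `α ⌣ α` multiply on the left), and nothing below depends on
commutativity.

* `mixedPow σ a b = σᵃ ⌣ σ̄ᵇ ∈ H^{2a+2b}(Y; ℂ)`;
* `beauvilleLinear μ σ a b h : H²(Y; ℂ) →ₗ[ℂ] ℂ`, `α ↦ ⟨α ⌣ (σᵃ ⌣ σ̄ᵇ), [Y]_μ⟩` (`2 + 2a + 2b = d`) —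
  the two linear forms of the second summand;
* `beauvilleBilin μ σ n hd : LinearMap.BilinForm ℂ H²(Y; ℂ)` (`hd : 4n = d`) — the bilinear form
  `B(α, β) = (n/2)⟨(α ⌣ β) ⌣ σ^{n-1}σ̄^{n-1}, [Y]⟩ + (1 - n) ℓ₁(α) ℓ₂(β)` whose diagonal is `f_σ`,
  defined by pattern matching on `n` (`n = m + 1`; for `n = 0`, i.e. `d = 0`, the value is the junk
  `0` — a `0`-dimensional `Y` has `H² = 0` anyway), so that no natural-number subtraction and no
  degree cast occurs: the exponents are `m`, `m + 1` and the degree equations are closed by `omega`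
  from `hd`;
* `beauvilleForm μ σ n hd : QuadraticForm ℂ H²(Y; ℂ)` — **Beauville's quadratic form `f_σ`**
  (`= q` of Beauville p. 772), the genuine Mathlib quadratic form `B.toQuadraticMap`;
* `IsBeauvilleNormalised μ σ n hd` — the normalisation `⟨σⁿ ⌣ σ̄ⁿ, [Y]_μ⟩ = 1` ("`∫(σσ̄)ⁿ = 1`").

Parameters and junk analysis. INTENDED INSTANCE: `Y = X(ℂ)` (or a compact complex manifold), `X`
irreducible symplectic of dimension `2n`, `μ` the orientation defined by the complex structure, `σ`
the class of a holomorphic symplectic form with `IsBeauvilleNormalised μ σ n hd`. (i) The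
orientation is a parameter because the tree does not yet construct the complex orientation of
`X(ℂ)` (cf. `HodgeTheory/GysinFormalism`, "Not here"); but the normalisation PINS it: for a
holomorphic symplectic `σ` on a connected `X`, `σⁿ ∧ σ̄ⁿ` is a POSITIVE multiple of the complex
volume form (in local coordinates `σⁿ = f dz₁ ∧ … ∧ dz_{2n}`, and
`dz_1 ∧ … ∧ dz_{2n} ∧ dz̄₁ ∧ … ∧ dz̄_{2n} = 4ⁿ · dx₁ ∧ dy₁ ∧ … ∧ dx_{2n} ∧ dy_{2n}`), so
`⟨σⁿσ̄ⁿ, [X]_μ⟩ = 1` is impossible for the opposite orientation — under `IsBeauvilleNormalised` the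
pair `(μ, σ)` is Beauville's. (ii) `σ` is a parameter because "the class of the symplectic form"
needs a Hodge model to be singled out (`HodgeTheory.IsOfHodgeType (2n) X 2 2 0 σ` on the scheme
side); Beauville's `f` does not depend on the choice of the NORMALISED `σ` — two such differ by a
phase `c`, `c c̄ = 1`, and `beauvilleForm_smul_of_mul_conj_eq_one` PROVES
`f_{cσ} = f_σ` for every such `c` (the exponents of `c` and `c̄` balance in both summands).
(iii) `n = 0` gives `0` (documented junk; then `d = 0`).

## API (all proved)

Unfolding lemmas (`mixedPow_def`, `beauvilleLinear_apply`, `beauvilleBilin_zero`,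
`beauvilleBilin_succ_apply`, `beauvilleForm_apply`, `beauvilleForm_zero`,
`isBeauvilleNormalised_iff`); **the printed formula** `beauvilleForm_succ_apply` (with the printed
coefficient `1 - n`); the surface case `beauvilleForm_one_apply`: for `n = 1` (K3, complex tori)
`f_σ(α) = ½ ⟨α ⌣ α, [Y]⟩` is half the intersection form, whatever `σ` (Beauville's normalisation of
`q` for `r = 1`); homogeneity `cupPowTwo_smul`, `mixedPow_smul`, `beauvilleLinear_smul` and the
phase invariance `beauvilleBilin_smul_of_mul_conj_eq_one`, `beauvilleForm_smul_of_mul_conj_eq_one`,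
`isBeauvilleNormalised_smul_iff`.

## Not here (each a theorem of the sources, to be cited against these definitions; no named facts
are introduced in this file)

Beauville's Théorème 5 (a) (`f_σ` is real on `H²(X, ℝ)`, non-degenerate of signature
`(3, b₂ - 3)`, and a positive real multiple of a PRIMITIVE INTEGRAL form `q_X` on `H²(X, ℤ)` — the
normalised "Beauville–Bogomolov(–Fujiki) form/lattice" `q_X = c · f_σ` is therefore NOT defined here:
singling out `c` requires the theorem); (b) (local Torelli); the Fujiki relation
`∫ β^{2n} = c_X q_X(β)ⁿ` (Huybrechts §1.11); the description `f(α) = (n/2)∫(σσ̄)^{n-1}β² + λλ̄` on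
the Hodge decomposition; the BB lattices of the known deformation types (e.g. OG6:
`U^{⊕3} ⊕ ⟨-2⟩^{⊕2}`, Rapagnetta 2008); the Looijenga–Lunts–Verbitsky Lie algebra.
-/

noncomputable section

open Literature.AlgebraicTopology.SingularHomology
open Literature.AlgebraicGeometry.HodgeTheory

namespace Literature.AlgebraicGeometry.Hyperkaehler

variable {Y : Type} [TopologicalSpace Y] {d : ℕ}

/-! ### Cup powers and the mixed powers `σᵃ ⌣ σ̄ᵇ` -/

/-- Homogeneity of cup powers: `(c • x)ⁱ = cⁱ • xⁱ` in `H²ⁱ(Y; ℂ)` (bilinearity of `⌣`, Hatcher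
§3.2). [cite: Hatcher2002, §3.2  p. 206] -/
theorem cupPowTwo_smul (c : ℂ) (x : singularCohomology ℂ ℂ Y 2) (i : ℕ) :
    cupPowTwo (c • x) i = c ^ i • cupPowTwo x i := by
  induction i with
  | zero => rw [cupPowTwo_zero, cupPowTwo_zero, pow_zero, one_smul]
  | succ i ih =>
    rw [cupPowTwo_succ, cupPowTwo_succ, ih, LinearMap.map_smul₂, map_smul, smul_smul, pow_succ]

/-- The **mixed power** `σᵃ ⌣ σ̄ᵇ ∈ H^{2a+2b}(Y; ℂ)` of a class `σ ∈ H²(Y; ℂ)` and its complex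
conjugate `σ̄ = conjClass Y 2 σ` (the classes `(σσ̄)^{n-1}`, `σ^{n-1}σ̄ⁿ`, `σⁿσ̄^{n-1}` of Beauville's
formula; all factors have even degree, so the printed products do not depend on the order — one
order is fixed here). [cite: Huybrechts1999, §1.9] -/
def mixedPow (σ : singularCohomology ℂ ℂ Y 2) (a b : ℕ) :
    singularCohomology ℂ ℂ Y (2 * a + 2 * b) :=
  cupProduct rfl (cupPowTwo σ a) (cupPowTwo (conjClass Y 2 σ) b)

/-- Unfolding lemma: `mixedPow σ a b = σᵃ ⌣ σ̄ᵇ`. [cite: Huybrechts1999, §1.9] -/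
theorem mixedPow_def (σ : singularCohomology ℂ ℂ Y 2) (a b : ℕ) :
    mixedPow σ a b = cupProduct rfl (cupPowTwo σ a) (cupPowTwo (conjClass Y 2 σ) b) :=
  rfl

/-- `σ⁰ ⌣ σ̄⁰ = 1 ⌣ 1 = 1`. [cite: Hatcher2002, §3.2  p. 211] -/
theorem mixedPow_zero_zero (σ : singularCohomology ℂ ℂ Y 2) :
    mixedPow σ 0 0 = singularCohomology.one ℂ Y :=
  one_cupProduct _

/-- Homogeneity of the mixed powers: `(cσ)ᵃ ⌣ (c̄σ̄)ᵇ = cᵃ c̄ᵇ • (σᵃ ⌣ σ̄ᵇ)` (conjugation is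
conjugate-linear, `conjClass_smul`; `⌣` is bilinear). [cite: VoisinHodgeI2002, Cor. 6.12] -/
theorem mixedPow_smul (c : ℂ) (σ : singularCohomology ℂ ℂ Y 2) (a b : ℕ) :
    mixedPow (c • σ) a b = (c ^ a * starRingEnd ℂ c ^ b) • mixedPow σ a b := by
  rw [mixedPow_def, mixedPow_def, conjClass_smul, cupPowTwo_smul, cupPowTwo_smul,
    LinearMap.map_smul₂, map_smul, smul_smul]

/-! ### Integration against the fundamental class: the linear forms of Beauville's formula -/

/-- The linear form `α ↦ ⟨α ⌣ (σᵃ ⌣ σ̄ᵇ), [Y]_μ⟩` on `H²(Y; ℂ)` ("`∫ σᵃ σ̄ᵇ α`"), for a homological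
`ℂ`-orientation `μ` of `Y` in dimension `d = 2 + 2a + 2b` (its fundamental class `[Y]_μ`,
`HomologicalOrientation.fundamentalClass`; the pairing `cupPairing μ h α β = ⟨α ⌣ β, [Y]_μ⟩`). With
`(a, b) = (n-1, n)` and `(n, n-1)` these are the two factors of the second summand of Beauville's
`q`. [cite: Huybrechts1999, §1.9] [cite: Beauville1983, §8 p. 772] -/
def beauvilleLinear (μ : HomologicalOrientation ℂ Y d) (σ : singularCohomology ℂ ℂ Y 2) (a b : ℕ)
    (h : 2 + (2 * a + 2 * b) = d) : singularCohomology ℂ ℂ Y 2 →ₗ[ℂ] ℂ :=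
  (cupPairing μ h).flip (mixedPow σ a b)

/-- Unfolding lemma: `beauvilleLinear μ σ a b h α = ⟨α ⌣ (σᵃ ⌣ σ̄ᵇ), [Y]_μ⟩`.
[cite: Huybrechts1999, §1.9] -/
theorem beauvilleLinear_apply (μ : HomologicalOrientation ℂ Y d) (σ : singularCohomology ℂ ℂ Y 2)
    (a b : ℕ) (h : 2 + (2 * a + 2 * b) = d) (α : singularCohomology ℂ ℂ Y 2) :
    beauvilleLinear μ σ a b h α =
      kroneckerPairing ℂ ℂ Y d (cupProduct h α (mixedPow σ a b)) μ.fundamentalClass :=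
  rfl

/-- Homogeneity in `σ`: `ℓ_{cσ} = cᵃ c̄ᵇ • ℓ_σ`. [cite: Huybrechts1999, §1.9] -/
theorem beauvilleLinear_smul (μ : HomologicalOrientation ℂ Y d) (c : ℂ)
    (σ : singularCohomology ℂ ℂ Y 2) (a b : ℕ) (h : 2 + (2 * a + 2 * b) = d) :
    beauvilleLinear μ (c • σ) a b h = (c ^ a * starRingEnd ℂ c ^ b) • beauvilleLinear μ σ a b h := by
  ext α
  rw [LinearMap.smul_apply, beauvilleLinear_apply, beauvilleLinear_apply, mixedPow_smul, map_smul,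
    map_smul, LinearMap.smul_apply]

/-! ### Beauville's bilinear and quadratic forms -/

/-- **Beauville's bilinear form** on `H²(Y; ℂ)` attached to an orientation `μ` in dimension
`d = 4n` and a class `σ ∈ H²(Y; ℂ)`: for `n = m + 1`,
`B(α, β) = (n/2) ⟨(α ⌣ β) ⌣ (σᵐ ⌣ σ̄ᵐ), [Y]_μ⟩ - m · ⟨α ⌣ (σᵐ ⌣ σ̄^{m+1}), [Y]_μ⟩ · ⟨β ⌣ (σ^{m+1} ⌣ σ̄ᵐ), [Y]_μ⟩`
(note `1 - n = -m`), whose diagonal `B(α, α)` is Beauville's `q(α)` / Huybrechts' `f(α)`; for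
`n = 0` (then `d = 0` and `Y` is meant to be a point) the junk value `0`. Defined by pattern matching
on `n` so that no truncated subtraction `n - 1` and no degree cast is needed. Not symmetrised (its
symmetry needs graded commutativity of `⌣`); only its diagonal is used. INTENDED: `Y = X(ℂ)`, `X`
irreducible symplectic of dimension `2n`, `μ` the complex orientation, `σ` the normalised class of
the symplectic form (module docstring, junk analysis (i)–(iii)).
[cite: Beauville1983, §8 p. 772] [cite: Huybrechts1999, §1.9] -/
def beauvilleBilin (μ : HomologicalOrientation ℂ Y d) (σ : singularCohomology ℂ ℂ Y 2) :
    (n : ℕ) → 4 * n = d → LinearMap.BilinForm ℂ (singularCohomology ℂ ℂ Y 2)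
  | 0, _ => 0
  | m + 1, hd =>
    ((m + 1 : ℂ) / 2) •
        (cupProduct two_add_two).compr₂
          ((cupPairing μ (by omega : 4 + (2 * m + 2 * m) = d)).flip (mixedPow σ m m)) -
      (m : ℂ) •
        (LinearMap.mul ℂ ℂ).compl₁₂ (beauvilleLinear μ σ m (m + 1) (by omega))
          (beauvilleLinear μ σ (m + 1) m (by omega))

/-- **Beauville's quadratic form** `f_σ` on `H²(Y; ℂ)` (Beauville 1983 p. 772: `q(α) =
(r/2)∫α²(φφ̄)^{r-1} + (1-r)(∫αφ^{r-1}φ̄ʳ)(∫αφʳφ̄^{r-1})`; Huybrechts 1999 §1.9: `f`), for an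
orientation `μ` in dimension `d = 4n` and a class `σ ∈ H²(Y; ℂ)`: the quadratic form
`α ↦ B(α, α)` of `beauvilleBilin` (a genuine `QuadraticForm`). For `Y = X(ℂ)`, `X` compact Kähler
irreducible symplectic of dimension `2n`, `μ` its complex orientation and `σ` the class of a
symplectic form with `IsBeauvilleNormalised μ σ n hd`, this IS Beauville's `q` = Huybrechts' `f`;
the Beauville–Bogomolov form of `X` is its unique positive real multiple that is primitive integral
on `H²(X, ℤ)` (Beauville Thm. 5 (a) — not defined here, see the module docstring).
[cite: Beauville1983, §8 p. 772 and Thm. 5] [cite: Huybrechts1999, §1.9] -/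
def beauvilleForm (μ : HomologicalOrientation ℂ Y d) (σ : singularCohomology ℂ ℂ Y 2) (n : ℕ)
    (hd : 4 * n = d) : QuadraticForm ℂ (singularCohomology ℂ ℂ Y 2) :=
  (beauvilleBilin μ σ n hd).toQuadraticMap

/-- **Beauville's normalisation** `∫ (σσ̄)ⁿ = 1` of the symplectic class, rendered
`⟨σⁿ ⌣ σ̄ⁿ, [Y]_μ⟩ = 1` (`2n + 2n = d`). For a holomorphic symplectic `σ` this forces `μ` to be the
complex orientation (module docstring, (i)). [cite: Beauville1983, §8 p. 772]
[cite: Huybrechts1999, §1.9] -/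
def IsBeauvilleNormalised (μ : HomologicalOrientation ℂ Y d) (σ : singularCohomology ℂ ℂ Y 2)
    (n : ℕ) (hd : 4 * n = d) : Prop :=
  cupPairing μ (by omega : 2 * n + 2 * n = d) (cupPowTwo σ n) (cupPowTwo (conjClass Y 2 σ) n) = 1

section API

variable (μ : HomologicalOrientation ℂ Y d) (σ : singularCohomology ℂ ℂ Y 2)

/-- Unfolding lemma for the normalisation: `⟨σⁿ ⌣ σ̄ⁿ, [Y]_μ⟩ = 1`. [cite: Huybrechts1999, §1.9] -/
theorem isBeauvilleNormalised_iff (n : ℕ) (hd : 4 * n = d) :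
    IsBeauvilleNormalised μ σ n hd ↔
      kroneckerPairing ℂ ℂ Y d (cupProduct (by omega : 2 * n + 2 * n = d) (cupPowTwo σ n)
        (cupPowTwo (conjClass Y 2 σ) n)) μ.fundamentalClass = 1 :=
  Iff.rfl

/-- In dimension `d = 0` (`n = 0`) the form is the junk value `0`. [cite: Huybrechts1999, §1.9] -/
@[simp]
theorem beauvilleBilin_zero (hd : 4 * 0 = d) : beauvilleBilin μ σ 0 hd = 0 :=
  rfl

/-- **Unfolding Beauville's bilinear form** for `n = m + 1`:
`B(α, β) = ((m+1)/2) ⟨(α ⌣ β) ⌣ (σᵐ ⌣ σ̄ᵐ), [Y]⟩ - m ⟨α ⌣ σᵐσ̄^{m+1}, [Y]⟩ ⟨β ⌣ σ^{m+1}σ̄ᵐ, [Y]⟩`.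
[cite: Beauville1983, §8 p. 772] -/
theorem beauvilleBilin_succ_apply (m : ℕ) (hd : 4 * (m + 1) = d)
    (α β : singularCohomology ℂ ℂ Y 2) :
    beauvilleBilin μ σ (m + 1) hd α β =
      (m + 1 : ℂ) / 2 *
          kroneckerPairing ℂ ℂ Y d
            (cupProduct (by omega : 4 + (2 * m + 2 * m) = d) (cupProduct two_add_two α β)
              (mixedPow σ m m)) μ.fundamentalClass -
        m * (beauvilleLinear μ σ m (m + 1) (by omega) α *
          beauvilleLinear μ σ (m + 1) m (by omega) β) :=
  rfl

/-- `f_σ(α) = B(α, α)`. [cite: Huybrechts1999, §1.9] -/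
theorem beauvilleForm_apply (n : ℕ) (hd : 4 * n = d) (α : singularCohomology ℂ ℂ Y 2) :
    beauvilleForm μ σ n hd α = beauvilleBilin μ σ n hd α α :=
  rfl

/-- In dimension `d = 0` the quadratic form is `0`. [cite: Huybrechts1999, §1.9] -/
@[simp]
theorem beauvilleForm_zero (hd : 4 * 0 = d) : beauvilleForm μ σ 0 hd = 0 := by
  ext α
  rfl

/-- **The printed formula** (Beauville p. 772 with `r = m + 1`; Huybrechts §1.9 with `n = m + 1`):
`f_σ(α) = (n/2) ⟨α² ⌣ σ^{n-1}σ̄^{n-1}, [Y]⟩ + (1 - n) ⟨α ⌣ σ^{n-1}σ̄ⁿ, [Y]⟩ · ⟨α ⌣ σⁿσ̄^{n-1}, [Y]⟩`.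
[cite: Beauville1983, §8 p. 772] [cite: Huybrechts1999, §1.9] -/
theorem beauvilleForm_succ_apply (m : ℕ) (hd : 4 * (m + 1) = d)
    (α : singularCohomology ℂ ℂ Y 2) :
    beauvilleForm μ σ (m + 1) hd α =
      ((m + 1 : ℕ) : ℂ) / 2 *
          kroneckerPairing ℂ ℂ Y d
            (cupProduct (by omega : 4 + (2 * m + 2 * m) = d) (cupProduct two_add_two α α)
              (mixedPow σ m m)) μ.fundamentalClass +
        (1 - ((m + 1 : ℕ) : ℂ)) * (beauvilleLinear μ σ m (m + 1) (by omega) α *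
          beauvilleLinear μ σ (m + 1) m (by omega) α) := by
  rw [beauvilleForm_apply, beauvilleBilin_succ_apply]
  push_cast
  ring

/-- **The surface case** `n = 1` (`d = 4`; K3 surfaces, complex tori): `f_σ(α) = ½ ⟨α ⌣ α, [Y]_μ⟩`
is half the intersection form, for every `σ` (Beauville's `q` for `r = 1`).
[cite: Beauville1983, §8 p. 772] -/
theorem beauvilleForm_one_apply (μ : HomologicalOrientation ℂ Y 4) (σ α : singularCohomology ℂ ℂ Y 2) :
    beauvilleForm μ σ 1 rfl α =
      1 / 2 * kroneckerPairing ℂ ℂ Y 4 (cupProduct two_add_two α α) μ.fundamentalClass := by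
  rw [beauvilleForm_apply, beauvilleBilin_succ_apply, mixedPow_zero_zero]
  have h : cupProduct (show 4 + (2 * 0 + 2 * 0) = 4 by rfl) (cupProduct two_add_two α α)
      (singularCohomology.one ℂ Y) = cupProduct two_add_two α α :=
    cupProduct_one _
  rw [h]
  push_cast
  ring

/-! ### Independence of the phase of `σ` -/

/-- **Beauville's form does not depend on the phase of `σ`**: `B_{cσ} = B_σ` whenever `c c̄ = 1`
(the first summand acquires `cᵐc̄ᵐ = 1`, the second `cᵐc̄^{m+1} · c^{m+1}c̄ᵐ = (cc̄)^{2m+1} = 1`). In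
particular `f_σ` is the same for all normalised symplectic classes, which differ by such phases.
[cite: Beauville1983, §8 p. 772] [cite: Huybrechts1999, §1.9] -/
theorem beauvilleBilin_smul_of_mul_conj_eq_one (n : ℕ) (hd : 4 * n = d) {c : ℂ}
    (hc : c * starRingEnd ℂ c = 1) :
    beauvilleBilin μ (c • σ) n hd = beauvilleBilin μ σ n hd := by
  cases n with
  | zero => rfl
  | succ m =>
    have h1 : c ^ m * starRingEnd ℂ c ^ m = 1 := by rw [← mul_pow, hc, one_pow]
    have h2 : c ^ m * starRingEnd ℂ c ^ (m + 1) * (c ^ (m + 1) * starRingEnd ℂ c ^ m) = 1 := by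
      calc c ^ m * starRingEnd ℂ c ^ (m + 1) * (c ^ (m + 1) * starRingEnd ℂ c ^ m)
          = (c * starRingEnd ℂ c) ^ (m + (m + 1)) := by ring
        _ = 1 := by rw [hc, one_pow]
    ext α β
    rw [beauvilleBilin_succ_apply, beauvilleBilin_succ_apply, mixedPow_smul, h1, one_smul,
      beauvilleLinear_smul, beauvilleLinear_smul, LinearMap.smul_apply, LinearMap.smul_apply,
      smul_eq_mul, smul_eq_mul]
    congr 1
    calc (m : ℂ) * (c ^ m * starRingEnd ℂ c ^ (m + 1) * beauvilleLinear μ σ m (m + 1) _ α *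
          (c ^ (m + 1) * starRingEnd ℂ c ^ m * beauvilleLinear μ σ (m + 1) m _ β))
        = (m : ℂ) * ((c ^ m * starRingEnd ℂ c ^ (m + 1) * (c ^ (m + 1) * starRingEnd ℂ c ^ m)) *
            (beauvilleLinear μ σ m (m + 1) (by omega) α *
              beauvilleLinear μ σ (m + 1) m (by omega) β)) := by ring
      _ = _ := by rw [h2, one_mul]

/-- `f_{cσ} = f_σ` for `c c̄ = 1`. [cite: Beauville1983, §8 p. 772] -/
theorem beauvilleForm_smul_of_mul_conj_eq_one (n : ℕ) (hd : 4 * n = d) {c : ℂ}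
    (hc : c * starRingEnd ℂ c = 1) :
    beauvilleForm μ (c • σ) n hd = beauvilleForm μ σ n hd := by
  unfold beauvilleForm
  rw [beauvilleBilin_smul_of_mul_conj_eq_one μ σ n hd hc]

/-- The normalisation is invariant under phases: `∫((cσ)(c̄σ̄))ⁿ = (cc̄)ⁿ ∫(σσ̄)ⁿ`.
[cite: Huybrechts1999, §1.9] -/
theorem isBeauvilleNormalised_smul_iff (n : ℕ) (hd : 4 * n = d) {c : ℂ}
    (hc : c * starRingEnd ℂ c = 1) :
    IsBeauvilleNormalised μ (c • σ) n hd ↔ IsBeauvilleNormalised μ σ n hd := by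
  have h1 : c ^ n * starRingEnd ℂ c ^ n = 1 := by rw [← mul_pow, hc, one_pow]
  unfold IsBeauvilleNormalised
  rw [conjClass_smul, cupPowTwo_smul, cupPowTwo_smul, LinearMap.map_smul₂, map_smul, smul_smul, h1,
    one_smul]

end API

end Literature.AlgebraicGeometry.Hyperkaehler

end
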